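import Summits.CriticalPhenomena.PercolationContinuityZ3.Theses.PercShatteringRace
import Literature.Probability.Percolation.SharpnessDCTProofs

/-!
# Crux `PercShatteringRace.NearLinearTwoClusterDecay` (stmt-CriticalPhenomena-5785), line `shell-product-kiss-positivity` — stub `stub_kissMerge`

Helper file for the lead's skeleton of line `shell-product-kiss-positivity`
(`Cruxes/NearLinearTwoClusterDecay/Lines/shell_product_kiss_positivity.lean`, skeleton rev L1-c1,
prover-line-stmt-CriticalPhenomena-5785-c1-0). Proves exactly the registered stub signature
`stub_kissMerge`; lands with `--supports stmt-CriticalPhenomena-5785`.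

## The statement (deterministic, generic over the shell `S` and the target sets `A`, `B`)

Write `{x ⟷ y in S} = openConnIn S x y`. A CROSSING POINT of `ω` is a point of `A` joined inside
`S` to `B`; a CROSSING FAMILY of size `n` is a map `x : Fin n → Site 3` of crossing points,
pairwise not joined inside `S`. The hypotheses say: `u ∼ v` are lattice neighbours, each joined
inside `S` to `A` and to `B`, not joined to each other inside `S`, and `ω` has a crossing family of
size `k + 1` but none of size `k + 2`. The conclusion: `insert s(u, v) ω` has a crossing family of
size `k` but none of size `k + 1` — **opening a kiss edge lowers the crossing number by exactly one**.

## The argument (paths inside `S`, `DCT16.mem_openConnIn_iff_pathIn`)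

* `NearLinearTwoClusterDecayKissMerge.pathIn_insert_or` — first/last use of the inserted edge: a
  path of `ω ∪ {uv}` inside `S` from `x` to `y` is a path of `ω`, or splits as `x ⟷ u`, `v ⟷ y`, or
  as `x ⟷ v`, `u ⟷ y` (all in `ω`, inside `S`); induction on the path (tree pattern
  `AKN.reachable_insert_or`).
* `…cross_of_insert` — hence crossing points of `ω ∪ {uv}` are crossing points of `ω` (`u` and `v`
  are already joined to `B` in `ω`).
* `…exists_pathIn_of_maximal` — if `x` is a crossing family of size `n` and there is none of size
  `n + 1`, every crossing point is joined to some `x i` (else prepend it: `Matrix.vecCons`).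
* Main step (`…kissMerge_pathIn`): for every crossing family `x'` of `ω` of size `k + 1`, the
  `A`-sources of `u` and `v` are crossing points, so `u ⟷ x' i` and `v ⟷ x' j` for some `i ≠ j`
  (`i = j` would join `u` to `v`). (ii) A crossing family of `ω ∪ {uv}` of size `k + 1` is one of
  `ω`; then `x' i ⟷ u — v ⟷ x' j` in `ω ∪ {uv}`: contradiction. (iii) From the given family `x` of
  `ω` drop the index `j₀` of `v`'s class (`Fin.succAbove`); two survivors joined in `ω ∪ {uv}` are
  joined in `ω` or one of them is `ω`-joined to `v`, i.e. to `x j₀`: contradiction either way.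

Tree API used: `DCT16.mem_openConnIn_iff_pathIn`, `PathIn.refl/tail/of_adj/trans/symm/mono_graph/
left_mem`, `openGraph_adj`, `openGraph_mono`; Mathlib `Sym2.eq_iff`, `Matrix.vecCons`,
`Fin.cases`, `Fin.eq_zero_or_eq_succ`, `Fin.succAbove_ne`, `Fin.succAbove_right_injective`.
No new definitions, no named facts.
-/

noncomputable section

open Literature.Probability.Percolation Literature.Probability.LatticeModels

namespace Summit.CriticalPhenomena.PercolationContinuityZ3.Theorems

namespace NearLinearTwoClusterDecayKissMerge

variable {V : Type*}

/-- **First use of an inserted edge, inside `S`.** A path of `openGraph (insert s(u, v) ω)` inside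
`S` from `x` to `y` is a path of `openGraph ω` inside `S`, or it splits into `ω`-paths inside `S`
`x ⟷ u` and `v ⟷ y`, or `x ⟷ v` and `u ⟷ y` (induction on the path; tree pattern
`AKN.reachable_insert_or`). [folklore] -/
theorem pathIn_insert_or {S : Set V} {ω : BondConfig V} {u v x y : V}
    (h : PathIn (openGraph (insert s(u, v) ω)) S x y) :
    PathIn (openGraph ω) S x y ∨ (PathIn (openGraph ω) S x u ∧ PathIn (openGraph ω) S v y) ∨
      (PathIn (openGraph ω) S x v ∧ PathIn (openGraph ω) S u y) := by
  obtain ⟨hx, hr⟩ := h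
  induction hr with
  | refl => exact Or.inl (PathIn.refl hx)
  | @tail b c _ hbc ih =>
    obtain ⟨hadj, hc⟩ := hbc
    rw [openGraph_adj, Set.mem_insert_iff] at hadj
    obtain ⟨hbc | hbc, hne⟩ := hadj
    · -- the last step is the inserted edge: `{b, c} = {u, v}`
      rcases Sym2.eq_iff.1 hbc with ⟨rfl, rfl⟩ | ⟨rfl, rfl⟩
      · rcases ih with h1 | ⟨h1, -⟩ | ⟨h1, -⟩
        · exact Or.inr (Or.inl ⟨h1, PathIn.refl hc⟩)
        · exact Or.inr (Or.inl ⟨h1, PathIn.refl hc⟩)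
        · exact Or.inl h1
      · rcases ih with h1 | ⟨h1, -⟩ | ⟨h1, -⟩
        · exact Or.inr (Or.inr ⟨h1, PathIn.refl hc⟩)
        · exact Or.inl h1
        · exact Or.inr (Or.inr ⟨h1, PathIn.refl hc⟩)
    · -- the last step is an `ω`-open edge
      have hbc' : (openGraph ω).Adj b c := (openGraph_adj ω b c).2 ⟨hbc, hne⟩
      rcases ih with h1 | ⟨h1, h2⟩ | ⟨h1, h2⟩
      · exact Or.inl (h1.tail hbc' hc)
      · exact Or.inr (Or.inl ⟨h1, h2.tail hbc' hc⟩)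
      · exact Or.inr (Or.inr ⟨h1, h2.tail hbc' hc⟩)

/-- **Crossing points do not change.** If `u` and `v` are joined inside `S` to `B` in `ω`, a point
of `A` joined inside `S` to `B` in `insert s(u, v) ω` is already so joined in `ω`: a path through
the new edge reaches `u` or `v` in `ω` first. [folklore] -/
theorem cross_of_insert {S A B : Set V} {ω : BondConfig V} {u v x : V}
    (hu : ∃ b ∈ B, PathIn (openGraph ω) S u b) (hv : ∃ b ∈ B, PathIn (openGraph ω) S v b)
    (h : x ∈ A ∧ ∃ b ∈ B, PathIn (openGraph (insert s(u, v) ω)) S x b) :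
    x ∈ A ∧ ∃ b ∈ B, PathIn (openGraph ω) S x b := by
  obtain ⟨hxA, b, hb, hxb⟩ := h
  refine ⟨hxA, ?_⟩
  rcases pathIn_insert_or hxb with h1 | ⟨h1, -⟩ | ⟨h1, -⟩
  · exact ⟨b, hb, h1⟩
  · obtain ⟨b', hb', hub'⟩ := hu
    exact ⟨b', hb', h1.trans hub'⟩
  · obtain ⟨b', hb', hvb'⟩ := hv
    exact ⟨b', hb', h1.trans hvb'⟩

/-- **Maximal crossing families meet every crossing class.** If `x : Fin n → V` is a family of
crossing points (points of `A` joined inside `S` to `B`) pairwise not joined inside `S`, and there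
is no such family of size `n + 1`, then every crossing point `a` is joined inside `S` to some `x i`
(otherwise prepend `a` to the family). [folklore] -/
theorem exists_pathIn_of_maximal {G : SimpleGraph V} {S A B : Set V} {n : ℕ} {x : Fin n → V}
    (hx : (∀ i, x i ∈ A ∧ ∃ b ∈ B, PathIn G S (x i) b) ∧ ∀ i j, i ≠ j → ¬ PathIn G S (x i) (x j))
    (hmax : ¬ ∃ y : Fin (n + 1) → V, (∀ i, y i ∈ A ∧ ∃ b ∈ B, PathIn G S (y i) b) ∧
      ∀ i j, i ≠ j → ¬ PathIn G S (y i) (y j))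
    {a : V} (ha : a ∈ A ∧ ∃ b ∈ B, PathIn G S a b) : ∃ i, PathIn G S a (x i) := by
  by_contra hno
  refine hmax ⟨Matrix.vecCons a x, fun i => ?_, fun i j hij => ?_⟩
  · refine Fin.cases ?_ (fun i' => ?_) i
    · simpa only [Matrix.cons_val_zero] using ha
    · simpa only [Matrix.cons_val_succ] using hx.1 i'
  · rcases Fin.eq_zero_or_eq_succ i with rfl | ⟨i', rfl⟩ <;>
      rcases Fin.eq_zero_or_eq_succ j with rfl | ⟨j', rfl⟩
    · exact absurd rfl hij
    · simp only [Matrix.cons_val_zero, Matrix.cons_val_succ]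
      exact fun h => hno ⟨j', h⟩
    · simp only [Matrix.cons_val_zero, Matrix.cons_val_succ]
      exact fun h => hno ⟨i', h.symm⟩
    · simp only [Matrix.cons_val_succ]
      exact hx.2 i' j' fun h => hij (congrArg Fin.succ h)

/-- **Opening a kiss edge lowers the crossing number by exactly one** (path form of
`stub_kissMerge`, generic vertex type). With `u ≠ v`, each of `u, v` joined inside `S` to `A` and
to `B` in `ω` but not to each other, and `ω` having a crossing family of size `k + 1` and none of
size `k + 2`: `insert s(u, v) ω` has a crossing family of size `k` and none of size `k + 1`.
For every size-`(k+1)` family `x'` of `ω`, `u ⟷ x' i` and `v ⟷ x' j` with `i ≠ j`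
(`exists_pathIn_of_maximal` at the `A`-sources of `u`, `v`); (ii) a size-`(k+1)` family of
`ω ∪ {uv}` is one of `ω` (`cross_of_insert`), and then `x' i ⟷ u — v ⟷ x' j`; (iii) drop `v`'s
index `j₀` from the given family (`Fin.succAbove`) and use `pathIn_insert_or`. [folklore] -/
theorem kissMerge_pathIn {S A B : Set V} {k : ℕ} {ω : BondConfig V} {u v : V} (hne : u ≠ v)
    (hu : ∃ a ∈ A, ∃ b ∈ B, PathIn (openGraph ω) S a u ∧ PathIn (openGraph ω) S u b)
    (hv : ∃ a ∈ A, ∃ b ∈ B, PathIn (openGraph ω) S a v ∧ PathIn (openGraph ω) S v b)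
    (huv : ¬ PathIn (openGraph ω) S u v)
    (hlev : (∃ x : Fin (k + 1) → V, (∀ i, x i ∈ A ∧ ∃ b ∈ B, PathIn (openGraph ω) S (x i) b) ∧
          ∀ i j, i ≠ j → ¬ PathIn (openGraph ω) S (x i) (x j)) ∧
        ¬ ∃ x : Fin (k + 1 + 1) → V, (∀ i, x i ∈ A ∧ ∃ b ∈ B, PathIn (openGraph ω) S (x i) b) ∧
          ∀ i j, i ≠ j → ¬ PathIn (openGraph ω) S (x i) (x j)) :
    (∃ x : Fin k → V, (∀ i, x i ∈ A ∧ ∃ b ∈ B, PathIn (openGraph (insert s(u, v) ω)) S (x i) b) ∧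
        ∀ i j, i ≠ j → ¬ PathIn (openGraph (insert s(u, v) ω)) S (x i) (x j)) ∧
      ¬ ∃ x : Fin (k + 1) → V,
        (∀ i, x i ∈ A ∧ ∃ b ∈ B, PathIn (openGraph (insert s(u, v) ω)) S (x i) b) ∧
          ∀ i j, i ≠ j → ¬ PathIn (openGraph (insert s(u, v) ω)) S (x i) (x j) := by
  obtain ⟨⟨x, hx⟩, hmax⟩ := hlev
  obtain ⟨au, hau, bu, hbu, hauu, hubu⟩ := hu
  obtain ⟨av, hav, bv, hbv, havv, hvbv⟩ := hv
  -- `openGraph ω ≤ openGraph (ω ∪ {uv})`, and the new edge joins `u` to `v` inside `S`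
  have hGG' : openGraph ω ≤ openGraph (insert s(u, v) ω) := openGraph_mono (Set.subset_insert _ _)
  have huv' : PathIn (openGraph (insert s(u, v) ω)) S u v :=
    PathIn.of_adj hubu.left_mem hvbv.left_mem ((openGraph_adj _ u v).2 ⟨Set.mem_insert _ _, hne⟩)
  -- the `A`-sources of `u` and `v` are crossing points of `ω`
  have hcu : au ∈ A ∧ ∃ b ∈ B, PathIn (openGraph ω) S au b := ⟨hau, bu, hbu, hauu.trans hubu⟩
  have hcv : av ∈ A ∧ ∃ b ∈ B, PathIn (openGraph ω) S av b := ⟨hav, bv, hbv, havv.trans hvbv⟩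
  -- KEY: every size-`(k+1)` crossing family of `ω` represents the classes of `u` and `v`,
  -- at two distinct indices
  have key : ∀ x' : Fin (k + 1) → V,
      ((∀ i, x' i ∈ A ∧ ∃ b ∈ B, PathIn (openGraph ω) S (x' i) b) ∧
        ∀ i j, i ≠ j → ¬ PathIn (openGraph ω) S (x' i) (x' j)) →
      ∃ i j, i ≠ j ∧ PathIn (openGraph ω) S u (x' i) ∧ PathIn (openGraph ω) S v (x' j) := by
    intro x' hx'
    obtain ⟨i, hi⟩ := exists_pathIn_of_maximal hx' hmax hcu
    obtain ⟨j, hj⟩ := exists_pathIn_of_maximal hx' hmax hcv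
    refine ⟨i, j, ?_, hauu.symm.trans hi, havv.symm.trans hj⟩
    rintro rfl
    exact huv ((hauu.symm.trans hi).trans (havv.symm.trans hj).symm)
  refine ⟨?_, ?_⟩
  · -- (iii) a crossing family of size `k` after insertion: drop the index of `v`'s class
    obtain ⟨-, j₀, -, -, hvj₀⟩ := key x hx
    refine ⟨fun i => x (j₀.succAbove i), fun i => ?_, fun i j hij h => ?_⟩
    · obtain ⟨hA, b, hb, hxb⟩ := hx.1 (j₀.succAbove i)
      exact ⟨hA, b, hb, hxb.mono_graph hGG'⟩
    · rcases pathIn_insert_or h with h1 | ⟨-, h2⟩ | ⟨h1, -⟩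
      · exact hx.2 _ _ (fun h' => hij (Fin.succAbove_right_injective h')) h1
      · exact hx.2 _ _ (Fin.succAbove_ne j₀ j) (h2.symm.trans hvj₀)
      · exact hx.2 _ _ (Fin.succAbove_ne j₀ i) (h1.trans hvj₀)
  · -- (ii) no crossing family of size `k + 1` after insertion
    rintro ⟨x', hx'1, hx'2⟩
    have hx'ω : (∀ i, x' i ∈ A ∧ ∃ b ∈ B, PathIn (openGraph ω) S (x' i) b) ∧
        ∀ i j, i ≠ j → ¬ PathIn (openGraph ω) S (x' i) (x' j) :=
      ⟨fun i => cross_of_insert ⟨bu, hbu, hubu⟩ ⟨bv, hbv, hvbv⟩ (hx'1 i),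
        fun i j hij h => hx'2 i j hij (h.mono_graph hGG')⟩
    obtain ⟨i, j, hij, hui, hvj⟩ := key x' hx'ω
    exact hx'2 i j hij (((hui.mono_graph hGG').symm.trans huv').trans (hvj.mono_graph hGG'))

end NearLinearTwoClusterDecayKissMerge

/-- **Registered stub `stub_kissMerge`** of line `shell-product-kiss-positivity` (crux
`NearLinearTwoClusterDecay`, stmt-CriticalPhenomena-5785): **opening a kiss edge lowers the
crossing number by exactly one.** If `u ∼ v` are lattice neighbours, each joined inside `S` to `A`
and to `B`, not joined to each other inside `S`, and `ω` has a family of `k + 1` points of `A`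
joined inside `S` to `B` and pairwise not joined inside `S`, but no such family of `k + 2` points,
then `insert s(u, v) ω` has such a family of `k` points and none of `k + 1`. Proof: rewrite
`{x ⟷ y in S}` as paths inside `S` (`DCT16.mem_openConnIn_iff_pathIn`) and apply
`NearLinearTwoClusterDecayKissMerge.kissMerge_pathIn`. [folklore] -/
theorem stub_kissMerge :
    ∀ (S A B : Set (Site 3)) (k : ℕ) (ω : BondConfig (Site 3)) (u v : Site 3),
      (zdGraph 3).Adj u v →
      (∃ a ∈ A, ∃ b ∈ B, ω ∈ openConnIn S a u ∧ ω ∈ openConnIn S u b) →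
      (∃ a ∈ A, ∃ b ∈ B, ω ∈ openConnIn S a v ∧ ω ∈ openConnIn S v b) →
      ω ∉ openConnIn S u v →
      ((∃ x : Fin (k + 1) → Site 3, (∀ i, x i ∈ A ∧ ∃ b ∈ B, ω ∈ openConnIn S (x i) b) ∧
          ∀ i j, i ≠ j → ω ∉ openConnIn S (x i) (x j)) ∧
        ¬ ∃ x : Fin (k + 1 + 1) → Site 3, (∀ i, x i ∈ A ∧ ∃ b ∈ B, ω ∈ openConnIn S (x i) b) ∧
          ∀ i j, i ≠ j → ω ∉ openConnIn S (x i) (x j)) →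
      (∃ x : Fin k → Site 3, (∀ i, x i ∈ A ∧ ∃ b ∈ B, insert s(u, v) ω ∈ openConnIn S (x i) b) ∧
          ∀ i j, i ≠ j → insert s(u, v) ω ∉ openConnIn S (x i) (x j)) ∧
        ¬ ∃ x : Fin (k + 1) → Site 3, (∀ i, x i ∈ A ∧ ∃ b ∈ B, insert s(u, v) ω ∈ openConnIn S (x i) b) ∧
          ∀ i j, i ≠ j → insert s(u, v) ω ∉ openConnIn S (x i) (x j) := by
  intro S A B k ω u v hadj hu hv huv hlev
  simp only [DCT16.mem_openConnIn_iff_pathIn] at hu hv huv hlev ⊢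
  exact NearLinearTwoClusterDecayKissMerge.kissMerge_pathIn hadj.ne hu hv huv hlev

end Summit.CriticalPhenomena.PercolationContinuityZ3.Theorems

end
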